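import Literature.Probability.RandomPlanarGeometry.LoewnerThrPieces
import HarnessLib

/-!
# Integrability of the through-swallow clock rate from STRICT closedness below the horizon

Topic `Probability/RandomPlanarGeometry`; one theorem (crux `stmt-CriticalPhenomena-0698`, stub
`stub_isLocal`, through-swallow image chain). `Loewner.integrableOn_thrClockRate`
(`LoewnerThrPieces.lean`) asks for closedness of the remaining hull `A ∖ K̂_t` for all `t ≤ β`; the
horizon construction delivers it for all paths only for `t < β` (and at `t = β` almost surely). Since
the rate `d_r² ∈ (0, 1]` is bounded, integrability on `[0, β]` follows from the strict version:
integrable on every `[0, β − 1/(n+1)]`, hence a.e.-strongly measurable on `[0, β)` (countable union),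
bounded by `1` on a set of finite measure, and `{β}` is null.
-/

noncomputable section

open Set Filter MeasureTheory
open scoped NNReal

namespace Literature.Probability.RandomPlanarGeometry

namespace Loewner

variable {W : ℝ≥0 → ℝ} {A : Set ℂ}

/-- **Integrability of the through-swallow clock rate on `[0, β]` from closedness of the remaining
hull strictly before `β`** and finiteness of its values on `[0, β]`. [folklore] -/
theorem integrableOn_thrClockRate_of_lt (hW : Continuous W) (hA : IsStarHull A) {β : ℝ≥0}
    (hcl : ∀ t < β, IsClosed (remHull W A t)) (hfin : (remHull W A '' Icc 0 β).Finite) :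
    IntegrableOn (thrClockRate W A) (Icc (0 : ℝ) β) := by
  -- integrable on each `[0, β_n]`, `β_n = β - 1/(n+1)` (when nonnegative)
  have hpiece : ∀ b : ℝ≥0, b < β → IntegrableOn (thrClockRate W A) (Icc (0 : ℝ) b) := by
    intro b hb
    refine integrableOn_thrClockRate hW hA (fun t ht ↦ hcl t (lt_of_le_of_lt ht hb)) ?_
    exact hfin.subset (image_mono (Icc_subset_Icc_right hb.le))
  -- a.e.-strong measurability on `[0, β)`
  have hcover : Ico (0 : ℝ) β = ⋃ n : ℕ, Icc (0 : ℝ) (((β : ℝ) - 1 / ((n : ℝ) + 1))) := by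
    apply Subset.antisymm
    · intro r hr
      obtain ⟨n, hn⟩ := exists_nat_one_div_lt (sub_pos.2 hr.2)
      exact mem_iUnion.2 ⟨n, hr.1, by linarith⟩
    · intro r hr
      obtain ⟨n, hn⟩ := mem_iUnion.1 hr
      have : (0 : ℝ) < 1 / ((n : ℝ) + 1) := by positivity
      exact ⟨hn.1, by linarith [hn.2]⟩
  have hmeas : AEStronglyMeasurable (thrClockRate W A) (volume.restrict (Ico (0 : ℝ) β)) := by
    rw [hcover]
    refine AEStronglyMeasurable.iUnion fun n ↦ ?_
    by_cases hn : (β : ℝ) - 1 / ((n : ℝ) + 1) < 0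
    · rw [Icc_eq_empty (by linarith), Measure.restrict_empty]
      exact aestronglyMeasurable_zero_measure _
    · push Not at hn
      set b : ℝ≥0 := ((β : ℝ) - 1 / ((n : ℝ) + 1)).toNNReal with hb
      have hbcoe : (b : ℝ) = (β : ℝ) - 1 / ((n : ℝ) + 1) := Real.coe_toNNReal _ hn
      have hbβ : b < β := by
        rw [← NNReal.coe_lt_coe, hbcoe]
        have : (0 : ℝ) < 1 / ((n : ℝ) + 1) := by positivity
        linarith
      have := (hpiece b hbβ).aestronglyMeasurable
      rwa [hbcoe] at this
  -- bounded by `1` on a finite-measure set, and `{β}` is null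
  have hIco : IntegrableOn (thrClockRate W A) (Ico (0 : ℝ) β) := by
    refine ⟨hmeas, HasFiniteIntegral.restrict_of_bounded (C := (1 : ℝ)) measure_Ico_lt_top ?_⟩
    exact (ae_restrict_iff' measurableSet_Ico).2 (ae_of_all _ fun r _ ↦ by
      rw [Real.norm_eq_abs, abs_of_pos (thrClockRate_pos_le_one W A r).1]
      exact (thrClockRate_pos_le_one W A r).2)
  have h0β : (0 : ℝ) ≤ β := β.coe_nonneg
  rw [← Ico_union_right h0β, integrableOn_union]
  exact ⟨hIco, integrableOn_singleton (by finiteness) (by rw [Real.volume_singleton]; exact ENNReal.zero_lt_top)⟩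

end Loewner

end Literature.Probability.RandomPlanarGeometry

end
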